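/-
Copyright (c) 2026 the pub-hodgecm-mathlib formalisation cell (harness21).  Prover seat hodgecm-mathlib-LH4-p19 (g3), req620 Track A «(D-RAM) FOUR-FRAME» squad
(STAGE-1b, row (2) of the piece `f_{T₊}`, the (β₂) road (R-36) «PURE-CELL LEDGER»; β₂ WORD #29∕#31 «p19: RAY BANDS» — the E-side digit count of an upper-line RAY cell:
a label read on a SPHERE of digits around a fixed centre), 2026-09-05.
-/
import Literature.NumberTheory.LocalFields.WildQuadraticDatumNormSignConductor               -- ★ (LH4-p06 (g3)): `sum_normSign_repr_eq_zero`, `normSign_mul_of_fixed`; brings ★ `normSign`, `IsRamifiedQuadraticDatum`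
import Summits.HodgeConjecture.HodgeConjecture.Theorems.F0P3cDyRamDiagonalCellLabelDigits     -- ★ p862655 (this lineage, K1): `sum_normSign_eq_card_sub_card`; brings ★ `normSign_eq_one_or`
import HarnessLib

/-!
# Crux `H413`, line LH4 «(D-RAM) FOUR-FRAME» — STAGE-1b, row (2), the (β₂) road (R-36), (OFF) residue, RAY bands: «A LABEL READ ON A SPHERE OF DIGITS IS BALANCED ON EVERY
# CLASS-CONSTANT PART» — `Σ_{V ∈ R, |γ₁(V − W₁)| = 1, C V} ω(γ₁(V − W₁)) = 0` (Serre V §3 Cor. 3 in representative currency; the ROOT regime of the affine label)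

Cell `hodgecm-mathlib` (D-0151), FLOOR 0, crux item H413 = `stmt-HodgeConjecture-24833`, route of record `HCCMUnconditional`; squad F0∕P3c∕LH4; lane
`--supports stmt-HodgeConjecture-24833 --as helper` (count-neutral; pays NO tier-0 row).  THEOREMS ONLY (no `def`, no instance, no notation, no `sorry`, default heartbeats);
★-only imports; states NO law; (β₂) stays a HYPOTHESIS.  DATUM-FREE E-side algebra: one valued field `K` with the sheet datum `IsRamifiedQuadraticDatum σ ϖ d t` (the fixed field
`F = K^σ` is never a type: «`V ∈ 𝒪_F ∕ 𝔭_F^·`» is a finite COMPLETE IRREDUNDANT SYSTEM OF REPRESENTATIVES `R ⊆ {σV = V, |V| ≤ 1}` for `|V − V′| ≤ |ϖ|^n`, as in ★ K1).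

WHY (this seat's RAYBANDS census, items A∕B, `F0/P3c/LH4/LH4-p19/g3/RAYBANDS.sig.v1.LH4p19g3.lean.txt`; β₂ WORD #29 «p19: RAY BANDS»).  On an upper-line cell of the (OFF) residue
(`j + m = jl + b`, `m < 2b`, RAY band `m⋆ ≤ s := m − b`, LOW band `m_c ≤ 2s`) the ray scalar of a glued vertex is `e₀ = pw·b̂·(V − W)` — an affine function of the vertex
coordinate `V` (★ p862871 `rayScalar_eq_affine`) whose ROOT `W` lies INSIDE the cell's digit ball: the depth token selects the ball `|V − W| ≤ |ϖE|^{…}` and the exact level `ℓ₀`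
(★ p863487, LH4-p12 (g9)'s `…UpperLineRayLetters`) selects the SPHERE `|γ₁(V − W₁)| = 1` (`γ₁ ≐ b̂∕t₊`, `W₁` the fixed part of `W`), on which the label is `ω(T)·ω(γ₁(V − W₁))`
(this seat's root-regime dictionary).  So the digit count (hbase) of the socket ★ `…ConeCellCountSocketDep` is NOT ★ K1's row regime (`|α₁| = 1` dominant, label set
`α₁·U_F^{(g)}`) but the SPHERE regime: the label set is ALL fixed units, and it must balance on every part of the sphere cut out by a side condition `C` (the literal's `Q`-class,
★ p863983) that is constant on `U_F^{(d−1)}`-cosets.  THIS FILE proves exactly that, from ★ `sum_normSign_repr_eq_zero` (a `U_F(2d−2)`-stable set of fixed units represented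
modulo `𝔭^ρ`, `ρ ≥ 2d − 1`, has sign sum zero):
* §1 `sum_normSign_sphere_repr_eq_zero` — `γ₁, W₁` fixed, `|W₁| ≤ 1 ≤ |γ₁|`, digits `R` modulo `|ϖ|^n` with `|γ₁|·|ϖ|^n = |ϖ|^ρ`, `2d − 1 ≤ ρ`, `C` constant on the cosets
  `|γ₁(V′ − V)| ≤ e^{−2(d−1)}` of sphere points: `Σ_{V ∈ R, |γ₁(V − W₁)| = 1 ∧ C V} ω(γ₁(V − W₁)) = 0` (the set `A = {y fixed unit : C(W₁ + y∕γ₁)}` is `U_F(2d−2)`-stable and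
  `V ↦ γ₁(V − W₁)` maps the sphere digits onto a complete irredundant system for `A` modulo `𝔭^ρ`).
* §2 HEAD `card_filter_sphere_plus_eq_card_filter_not` — the count: for `s₀ ∈ {1, −1}`, `#{V ∈ R ∣ (sphere ∧ C) ∧ ω(γ₁(V − W₁)) = s₀} = #{V ∈ R ∣ (sphere ∧ C) ∧ ¬ …}`.
WHAT IS NOT CLAIMED: the identification of `γ₁, W₁` (this seat's line-model file), the literal class `C` (★ p863983), the fibration (★ p864078), any census identity.
HONEST LABEL.  Count-neutral finite counting over norm classes; nothing printed is asserted; no census law is stated; `hU_ray`, `hD_ray`, `hL_ray` stay OPEN; `HC_CM` is proved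
only modulo the 7 printed citations (2 remaining named inputs: hLiu418 = `stmt-HodgeConjecture-24832`, h413 = `stmt-HodgeConjecture-24833`) until rung 0 closes.
## References
* [Serre1979] J.-P. Serre, *Local Fields*, GTM 67 (1979): Ch. V §3 Prop. 5, Cor. 3 pp. 85–87 (conductor of a ramified quadratic extension), Ch. XV §2 (norm residue symbol on `U^{(n)}`).
* [Kottwitz1986BaseChangeUnits] R. E. Kottwitz, *Base change for unit elements of Hecke algebras*, Compositio Math. 60 (1986): §1 pp. 240–241 (fixed-lattice counts as orbital integrals).
* [Rogawski1990] J. D. Rogawski, *Automorphic Representations of Unitary Groups in Three Variables*, Ann. of Math. Stud. 123 (1990): §4.9 Prop. 4.9.1 (b) p. 55, §12.2 (κ-signed counts).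
* [LabesseLanglands1979] J.-P. Labesse, R. P. Langlands, *L-indistinguishability for SL(2)*, Canad. J. Math. 31 (1979): §2 (2.2) p. 9 (a ramified character sums to zero on deep shells).
-/

set_option autoImplicit false

noncomputable section

namespace Summit.HodgeConjecture.HodgeConjecture.Cruxes.H413.F0P3cDyRamSphereLabelDigits

open scoped Valued WithZero
open WithZero Finset
open Literature.NumberTheory.Automorphic.UnitaryThreeFourFrame (IsRamifiedQuadraticDatum normSign)
open Literature.NumberTheory.LocalFields.WildQuadraticDatum (sum_normSign_repr_eq_zero)
open Summit.HodgeConjecture.HodgeConjecture.Cruxes.H413.F0P3cDyRamNormPairsIffFrames (normSign_eq_one_or)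
open Summit.HodgeConjecture.HodgeConjecture.Cruxes.H413.F0P3cDyRamDiagonalCellLabelDigits (sum_normSign_eq_card_sub_card)

variable {K : Type} [Field K] [Valued K ℤᵐ⁰] {σ : K →+* K} {ϖ : K} {d t : ℕ}

/-! ## §1 The sphere sum -/

/-- **THE SPHERE SUM VANISHES ON EVERY CLASS-CONSTANT PART.**  At a complete sheet datum with finite residue field and `|2| < 1`: `σ`-fixed `γ₁, W₁` with `|W₁| ≤ 1 ≤ |γ₁|`; a complete
irredundant system `R` of `σ`-fixed integers modulo `|·| ≤ |ϖ|^n`, FINE ENOUGH: `|γ₁|·|ϖ|^n = |ϖ|^ρ` with `2d − 1 ≤ ρ`; a side condition `C` which is constant along the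
`U_F^{(d−1)}`-cosets of the sphere (`|γ₁(V − W₁)| = 1`, `|γ₁(V′ − V)| ≤ e^{−2(d−1)}` ⟹ `C V ↔ C V′`).  THEN `Σ_{V ∈ R, |γ₁(V − W₁)| = 1 ∧ C V} ω(γ₁(V − W₁)) = 0` — the
image `γ₁(R_sphere − W₁)` is a complete irredundant system modulo `𝔭^ρ` of the `U_F(2d−2)`-stable set `{y fixed unit : C(W₁ + y∕γ₁)}`, ★ `sum_normSign_repr_eq_zero`.
[cite: Serre1979, Ch. V §3 Cor. 3 pp. 85–87; Ch. XV §2] [cite: LabesseLanglands1979, §2 (2.2) p. 9] -/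
theorem sum_normSign_sphere_repr_eq_zero [CompleteSpace K] [Finite 𝓀[K]] (hD : IsRamifiedQuadraticDatum σ ϖ d t) (h2v : Valued.v (2 : K) < 1)
    {γ₁ W₁ : K} (hσγ : σ γ₁ = γ₁) (hγ : 1 ≤ Valued.v γ₁) (hσW : σ W₁ = W₁) (hW : Valued.v W₁ ≤ 1)
    {n ρ : ℕ} (hγn : Valued.v γ₁ * Valued.v ϖ ^ n = Valued.v ϖ ^ ρ) (hρ : 2 * d - 1 ≤ ρ)
    (R : Finset K) (hR1 : ∀ V ∈ R, σ V = V ∧ Valued.v V ≤ 1)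
    (hR2 : ∀ V : K, σ V = V → Valued.v V ≤ 1 → ∃ V₀ ∈ R, Valued.v (V - V₀) ≤ Valued.v ϖ ^ n)
    (hR3 : ∀ V ∈ R, ∀ V' ∈ R, Valued.v (V - V') ≤ Valued.v ϖ ^ n → V = V')
    (C : K → Prop) [DecidablePred C]
    (hC : ∀ V V' : K, σ V = V → Valued.v V ≤ 1 → σ V' = V' → Valued.v V' ≤ 1 → Valued.v (γ₁ * (V - W₁)) = 1 →
      Valued.v (γ₁ * (V' - V)) ≤ exp (-(2 * ((d - 1 : ℕ) : ℤ))) → (C V ↔ C V')) :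
    ∑ V ∈ R.filter (fun V => Valued.v (γ₁ * (V - W₁)) = 1 ∧ C V), normSign σ (γ₁ * (V - W₁)) = 0 := by
  classical
  obtain ⟨hσσ, hvσ, hϖ, hfix, hdd, hd1, ht⟩ := id hD
  have hvϖ0 : Valued.v ϖ ≠ 0 := by rw [hϖ]; exact exp_ne_zero
  have hϖlt : Valued.v ϖ < 1 := by rw [hϖ, ← exp_zero, exp_lt_exp]; norm_num
  have hϖ1 : Valued.v ϖ ≤ 1 := hϖlt.le
  have hγpos : (0 : ℤᵐ⁰) < Valued.v γ₁ := lt_of_lt_of_le one_pos hγ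
  have hγ0 : γ₁ ≠ 0 := (Valuation.ne_zero_iff _).1 hγpos.ne'
  have hρ1 : 1 ≤ ρ := by omega
  have hϖρlt : Valued.v ϖ ^ ρ < 1 := pow_lt_one₀ zero_le hϖlt (by omega)
  have hϖρd : Valued.v ϖ ^ ρ ≤ exp (-(2 * ((d - 1 : ℕ) : ℤ))) := by
    rw [Literature.NumberTheory.LocalFields.WildQuadraticDatum.v_varpi_pow hϖ, exp_le_exp]; omega
  -- `|y∕γ₁| ≤ 1` for a unit `y`
  have hdivle : ∀ y : K, Valued.v y = 1 → Valued.v (y / γ₁) ≤ 1 := fun y hy => by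
    rw [map_div₀, hy, one_div]; exact inv_le_one_of_one_le₀ hγ
  -- the point of the sphere with label value `y`
  have hpt : ∀ y : K, σ y = y → Valued.v y = 1 → σ (W₁ + y / γ₁) = W₁ + y / γ₁ ∧ Valued.v (W₁ + y / γ₁) ≤ 1 ∧ γ₁ * (W₁ + y / γ₁ - W₁) = y := fun y hσy hy =>
    ⟨by rw [map_add, map_div₀, hσW, hσy, hσγ], (Valuation.map_add _ _ _).trans (max_le hW (hdivle y hy)), by field_simp; ring⟩
  -- the set `A` and its `U_F(2d−2)`-stability
  set A : Set K := {y | σ y = y ∧ Valued.v y = 1 ∧ C (W₁ + y / γ₁)} with hAdef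
  have hA : ∀ f ∈ A, σ f = f ∧ Valued.v f = 1 := fun f hf => ⟨hf.1, hf.2.1⟩
  have hAst : ∀ f ∈ A, ∀ a : K, σ a = a → Valued.v a = 1 → Valued.v (a - 1) ≤ exp (-(2 * ((d - 1 : ℕ) : ℤ))) → a * f ∈ A := by
    rintro f ⟨hσf, hf1, hCf⟩ a hσa ha1 had
    have hσaf : σ (a * f) = a * f := by rw [map_mul, hσa, hσf]
    have haf1 : Valued.v (a * f) = 1 := by rw [Valuation.map_mul, ha1, hf1, mul_one]
    obtain ⟨hσV, hV1, hVy⟩ := hpt f hσf hf1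
    obtain ⟨hσV', hV'1, hV'y⟩ := hpt (a * f) hσaf haf1
    refine ⟨hσaf, haf1, ?_⟩
    refine (hC (W₁ + f / γ₁) (W₁ + a * f / γ₁) hσV hV1 hσV' hV'1 (by rw [hVy, hf1]) ?_).1 hCf
    have e : γ₁ * (W₁ + a * f / γ₁ - (W₁ + f / γ₁)) = (a - 1) * f := by field_simp; ring
    rw [e, Valuation.map_mul, hf1, mul_one]
    exact had
  -- the label map on the sphere digits
  set S : Finset K := R.filter (fun V => Valued.v (γ₁ * (V - W₁)) = 1 ∧ C V) with hSdef
  set g : K → K := fun V => γ₁ * (V - W₁) with hgdef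
  have hginj : Set.InjOn g R := by
    intro V _ V' _ h
    have h' : γ₁ * (V - W₁) = γ₁ * (V' - W₁) := h
    have := mul_left_cancel₀ hγ0 h'
    linear_combination this
  have hS1 : ∀ y ∈ S.image g, y ∈ A := by
    intro y hy
    obtain ⟨V, hV, rfl⟩ := mem_image.1 hy
    obtain ⟨hVR, hVsph, hCV⟩ := mem_filter.1 hV
    obtain ⟨hσV, -⟩ := hR1 V hVR
    refine ⟨by rw [hgdef, map_mul, map_sub, hσγ, hσV, hσW], hVsph, ?_⟩
    have e : W₁ + γ₁ * (V - W₁) / γ₁ = V := by field_simp; ring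
    rw [hgdef]; dsimp only; rw [e]; exact hCV
  have hS2 : ∀ f ∈ A, ∃ y ∈ S.image g, Valued.v (f - y) ≤ Valued.v ϖ ^ ρ := by
    rintro f ⟨hσf, hf1, hCf⟩
    obtain ⟨hσV, hV1, hVy⟩ := hpt f hσf hf1
    obtain ⟨V₀, hV₀R, hVV₀⟩ := hR2 _ hσV hV1
    obtain ⟨hσV₀, hV₀1⟩ := hR1 V₀ hV₀R
    have hnear : Valued.v (γ₁ * (V₀ - (W₁ + f / γ₁))) ≤ Valued.v ϖ ^ ρ := by
      rw [Valuation.map_mul, ← hγn, ← neg_sub, Valuation.map_neg]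
      exact mul_le_mul' le_rfl hVV₀
    -- `V₀` lies on the sphere and in the class of `V`
    have hsph : Valued.v (γ₁ * (V₀ - W₁)) = 1 := by
      have e : γ₁ * (V₀ - W₁) = f + γ₁ * (V₀ - (W₁ + f / γ₁)) := by field_simp; ring
      rw [e, Valuation.map_add_eq_of_lt_left _ (by rw [hf1]; exact hnear.trans_lt hϖρlt), hf1]
    have hCV₀ : C V₀ := (hC _ V₀ hσV hV1 hσV₀ hV₀1 (by rw [hVy, hf1]) (hnear.trans hϖρd)).1 hCf
    refine ⟨g V₀, mem_image.2 ⟨V₀, mem_filter.2 ⟨hV₀R, hsph, hCV₀⟩, rfl⟩, ?_⟩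
    have e : f - g V₀ = -(γ₁ * (V₀ - (W₁ + f / γ₁))) := by rw [hgdef]; field_simp; ring
    rw [e, Valuation.map_neg]
    exact hnear
  have hS3 : ∀ y ∈ S.image g, ∀ y' ∈ S.image g, Valued.v (y - y') ≤ Valued.v ϖ ^ ρ → y = y' := by
    intro y hy y' hy' hyy
    obtain ⟨V, hV, rfl⟩ := mem_image.1 hy
    obtain ⟨V', hV', rfl⟩ := mem_image.1 hy'
    have hVR := (mem_filter.1 hV).1
    have hV'R := (mem_filter.1 hV').1
    have e : g V - g V' = γ₁ * (V - V') := by rw [hgdef]; ring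
    rw [e, Valuation.map_mul, ← hγn] at hyy
    rw [hR3 V hVR V' hV'R (le_of_mul_le_mul_left hyy hγpos)]
  have hsum := sum_normSign_repr_eq_zero hD h2v hρ hA hAst (S.image g) hS1 hS2 hS3
  rwa [sum_image (fun V hV V' hV' h => hginj (mem_filter.1 hV).1 (mem_filter.1 hV').1 h)] at hsum

/-! ## §2 HEAD — the count -/

/-- **HEAD — «THE SPHERE LABEL IS BALANCED ON EVERY CLASS-CONSTANT PART OF THE DIGITS».**  Letters of §1 and a sign `s₀ ∈ {1, −1}`:
`#{V ∈ R ∣ (|γ₁(V − W₁)| = 1 ∧ C V) ∧ ω(γ₁(V − W₁)) = s₀} = #{V ∈ R ∣ (|γ₁(V − W₁)| = 1 ∧ C V) ∧ ¬ ω(γ₁(V − W₁)) = s₀}` — the (hbase) letter of ★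
`…ConeCellCountSocketDep.cellDiff_eq_zero_of_fibration_reads₄` in the root regime (`NX := |γ₁(· − W₁)| = 1`, `ψ := ω(γ₁(· − W₁)) = s₀`, after `Finset.filter_filter`).
[cite: Serre1979, Ch. V §3 Cor. 3 pp. 85–87; Ch. XV §2] [cite: Kottwitz1986BaseChangeUnits, §1 pp. 240–241] [cite: Rogawski1990, §4.9 Prop. 4.9.1 (b) p. 55] -/
theorem card_filter_sphere_plus_eq_card_filter_not [CompleteSpace K] [Finite 𝓀[K]] (hD : IsRamifiedQuadraticDatum σ ϖ d t) (h2v : Valued.v (2 : K) < 1)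
    {γ₁ W₁ : K} (hσγ : σ γ₁ = γ₁) (hγ : 1 ≤ Valued.v γ₁) (hσW : σ W₁ = W₁) (hW : Valued.v W₁ ≤ 1)
    {n ρ : ℕ} (hγn : Valued.v γ₁ * Valued.v ϖ ^ n = Valued.v ϖ ^ ρ) (hρ : 2 * d - 1 ≤ ρ)
    (R : Finset K) (hR1 : ∀ V ∈ R, σ V = V ∧ Valued.v V ≤ 1)
    (hR2 : ∀ V : K, σ V = V → Valued.v V ≤ 1 → ∃ V₀ ∈ R, Valued.v (V - V₀) ≤ Valued.v ϖ ^ n)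
    (hR3 : ∀ V ∈ R, ∀ V' ∈ R, Valued.v (V - V') ≤ Valued.v ϖ ^ n → V = V')
    (C : K → Prop) [DecidablePred C]
    (hC : ∀ V V' : K, σ V = V → Valued.v V ≤ 1 → σ V' = V' → Valued.v V' ≤ 1 → Valued.v (γ₁ * (V - W₁)) = 1 →
      Valued.v (γ₁ * (V' - V)) ≤ exp (-(2 * ((d - 1 : ℕ) : ℤ))) → (C V ↔ C V'))
    {s₀ : ℤ} (hs₀ : s₀ = 1 ∨ s₀ = -1) :
    ((R.filter (fun V => Valued.v (γ₁ * (V - W₁)) = 1 ∧ C V)).filter fun V => normSign σ (γ₁ * (V - W₁)) = s₀).card =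
      ((R.filter (fun V => Valued.v (γ₁ * (V - W₁)) = 1 ∧ C V)).filter fun V => ¬ normSign σ (γ₁ * (V - W₁)) = s₀).card := by
  classical
  set S : Finset K := R.filter (fun V => Valued.v (γ₁ * (V - W₁)) = 1 ∧ C V) with hSdef
  have hsum := sum_normSign_sphere_repr_eq_zero hD h2v hσγ hγ hσW hW hγn hρ R hR1 hR2 hR3 C hC
  rw [sum_normSign_eq_card_sub_card σ S (fun V => γ₁ * (V - W₁))] at hsum
  have hneg : (S.filter fun V => ¬ normSign σ (γ₁ * (V - W₁)) = 1) = S.filter fun V => normSign σ (γ₁ * (V - W₁)) = -1 := by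
    refine filter_congr fun V _ => ?_
    rcases normSign_eq_one_or σ (γ₁ * (V - W₁)) with h | h
    · rw [h]; norm_num
    · rw [h]; norm_num
  have hpos : (S.filter fun V => ¬ normSign σ (γ₁ * (V - W₁)) = -1) = S.filter fun V => normSign σ (γ₁ * (V - W₁)) = 1 := by
    refine filter_congr fun V _ => ?_
    rcases normSign_eq_one_or σ (γ₁ * (V - W₁)) with h | h
    · rw [h]; norm_num
    · rw [h]; norm_num
  rcases hs₀ with rfl | rfl
  · rw [hneg]; omega
  · rw [hpos]; omega

end Summit.HodgeConjecture.HodgeConjecture.Cruxes.H413.F0P3cDyRamSphereLabelDigits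

end
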